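import Summits.Ventures.PercRepro.Night2CoverBasesTwoFat

/-!
# PercRepro — the THREE-hyperplane count of the covering bases: three fat hyperplanes with pairwise DISJOINT
missed sets (night-2, gen 23)

`Night2CoverBasesTwoFat` bounds the covering bases of a target through the inclusion–exclusion over TWO rank-`≤ q`
sets.  This file does the same over THREE such sets `H₀, H₁, H₂ ⊇ K` of `G` missing `≤ 2` points each with pairwise
DISJOINT missed sets:

* `card_coverBases_le_of_three_subset_rank` — the exact three-set inclusion–exclusion: no covering basis lies inside
  any `H_i`, so `#cb + Σ_i C(b_i, ρ) + C(y, ρ) ≤ C(s, ρ) + Σ_{i<j} C(x_ij, ρ)` with `b_i = |S′ ∩ H_i|`,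
  `x_ij = |S′ ∩ H_i ∩ H_j|`, `y = |S′ ∩ H₀ ∩ H₁ ∩ H₂|`;
* `card_inter_three_add_ge` — `y + Σ_i |S′ ∖ H_i| ≥ |S′|`;
* `choose_three_disjoint_le` — the binomial convexity behind the worst case (27 cases, `p_i = 2 − a_i`):
  `3·C(m+4) + Σ_{i<j} C(m+2+p_i+p_j) ≤ Σ_i C(m+4+p_i) + 3·C(m+2) + C(m+p₀+p₁+p₂)` (top index `t + 3`);
* **`card_coverBases_le_cntDisjThree`**: `#coverBases(S) ≤ cntDisjThree ρ |S ∖ K|` with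
  `cntDisjThree ρ s = C(s, ρ) − 3·C(s − 2, ρ) + 3·C(s − 4, ρ)` for every target `S ⊆ G` (`ρ ≥ 4`).

The exact count of the `ρ`-subsets of an `s`-set meeting three disjoint pairs is
`C(s, ρ) − 3C(s−2, ρ) + 3C(s−4, ρ) − C(s−6, ρ)`; the bound drops the last term.  With the chord excess of gen 20 the
count sums of `localShadowHall_excess_of_count` are `≥ 1` at `(3, 1)`, `n = 10 … 14` (`1.096 / 1.060 / 1.084 / 1.158 /
1.288`) and at `(3, 0)`, `n = 10, 12` (`1.022 / 1.012`) — the cells of `Night2ThreeFatCells`.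
-/

namespace PercRepro.Shadow

open Finset PerFlat ThmH

/-- The count function of three fat hyperplanes with pairwise disjoint missed sets of size `≤ 2`:
`C(s, ρ) − 3·C(s − 2, ρ) + 3·C(s − 4, ρ)`. -/
noncomputable def cntDisjThree (ρ s : ℕ) : ℚ :=
  (s.choose ρ : ℚ) - 3 * ((s - 2).choose ρ : ℚ) + 3 * ((s - 4).choose ρ : ℚ)

/-- `cntDisjThree 5 s > 0` for `6 ≤ s ≤ 16`. -/
theorem cntDisjThree_five_pos : ∀ s, 6 ≤ s → s ≤ 16 → 0 < cntDisjThree 5 s := by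
  intro s h1 h2
  unfold cntDisjThree
  interval_cases s <;> norm_num [Nat.choose_eq_descFactorial_div_factorial, Nat.descFactorial, Nat.factorial]

/-- `cntDisjThree 6 s > 0` for `7 ≤ s ≤ 13`. -/
theorem cntDisjThree_six_pos : ∀ s, 7 ≤ s → s ≤ 13 → 0 < cntDisjThree 6 s := by
  intro s h1 h2
  unfold cntDisjThree
  interval_cases s <;> norm_num [Nat.choose_eq_descFactorial_div_factorial, Nat.descFactorial, Nat.factorial]

/-- **Binomial convexity behind the three-disjoint-hyperplane count.** With `p_i = 2 − a_i` (`a_i` = the points of the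
target missed by the `i`-th hyperplane), the traces are `m + 4 + p_i`, the pairwise traces `m + 2 + p_i + p_j` and the
triple trace `m + p₀ + p₁ + p₂` (`s = m + 6`):
`3·C(m+4) + Σ_{i<j} C(m+2+p_i+p_j) ≤ Σ_i C(m+4+p_i) + 3·C(m+2) + C(m+p₀+p₁+p₂)` (top index `t + 3`). -/
theorem choose_three_disjoint_le (t m p₀ p₁ p₂ : ℕ) (h₀ : p₀ ≤ 2) (h₁ : p₁ ≤ 2) (h₂ : p₂ ≤ 2) :
    3 * (m + 4).choose (t + 3) + (m + 2 + p₀ + p₁).choose (t + 3) + (m + 2 + p₀ + p₂).choose (t + 3) +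
        (m + 2 + p₁ + p₂).choose (t + 3) ≤
      (m + 4 + p₀).choose (t + 3) + (m + 4 + p₁).choose (t + 3) + (m + 4 + p₂).choose (t + 3) +
        3 * (m + 2).choose (t + 3) + (m + p₀ + p₁ + p₂).choose (t + 3) := by
  have a0 : (m + 1).choose (t + 3) = m.choose (t + 2) + m.choose (t + 3) := Nat.choose_succ_succ m (t + 2)
  have a1 : (m + 2).choose (t + 3) = (m + 1).choose (t + 2) + (m + 1).choose (t + 3) :=
    Nat.choose_succ_succ (m + 1) (t + 2)
  have a2 : (m + 3).choose (t + 3) = (m + 2).choose (t + 2) + (m + 2).choose (t + 3) :=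
    Nat.choose_succ_succ (m + 2) (t + 2)
  have a3 : (m + 4).choose (t + 3) = (m + 3).choose (t + 2) + (m + 3).choose (t + 3) :=
    Nat.choose_succ_succ (m + 3) (t + 2)
  have a4 : (m + 5).choose (t + 3) = (m + 4).choose (t + 2) + (m + 4).choose (t + 3) :=
    Nat.choose_succ_succ (m + 4) (t + 2)
  have a5 : (m + 6).choose (t + 3) = (m + 5).choose (t + 2) + (m + 5).choose (t + 3) :=
    Nat.choose_succ_succ (m + 5) (t + 2)
  have b0 : (m + 1).choose (t + 2) = m.choose (t + 1) + m.choose (t + 2) := Nat.choose_succ_succ m (t + 1)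
  have b1 : (m + 2).choose (t + 2) = (m + 1).choose (t + 1) + (m + 1).choose (t + 2) :=
    Nat.choose_succ_succ (m + 1) (t + 1)
  have b2 : (m + 3).choose (t + 2) = (m + 2).choose (t + 1) + (m + 2).choose (t + 2) :=
    Nat.choose_succ_succ (m + 2) (t + 1)
  have b3 : (m + 4).choose (t + 2) = (m + 3).choose (t + 1) + (m + 3).choose (t + 2) :=
    Nat.choose_succ_succ (m + 3) (t + 1)
  have b4 : (m + 5).choose (t + 2) = (m + 4).choose (t + 1) + (m + 4).choose (t + 2) :=
    Nat.choose_succ_succ (m + 4) (t + 1)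
  have c0 : (m + 1).choose (t + 1) = m.choose t + m.choose (t + 1) := Nat.choose_succ_succ m t
  have c1 : (m + 2).choose (t + 1) = (m + 1).choose t + (m + 1).choose (t + 1) :=
    Nat.choose_succ_succ (m + 1) t
  have c2 : (m + 3).choose (t + 1) = (m + 2).choose t + (m + 2).choose (t + 1) :=
    Nat.choose_succ_succ (m + 2) t
  have c3 : (m + 4).choose (t + 1) = (m + 3).choose t + (m + 3).choose (t + 1) :=
    Nat.choose_succ_succ (m + 3) t
  have d0 : m.choose t ≤ (m + 1).choose t := Nat.choose_le_choose t (by omega)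
  have d1 : (m + 1).choose t ≤ (m + 2).choose t := Nat.choose_le_choose t (by omega)
  have d2 : (m + 2).choose t ≤ (m + 3).choose t := Nat.choose_le_choose t (by omega)
  have e0 : m.choose (t + 1) ≤ (m + 1).choose (t + 1) := Nat.choose_le_choose (t + 1) (by omega)
  have e1 : (m + 1).choose (t + 1) ≤ (m + 2).choose (t + 1) := Nat.choose_le_choose (t + 1) (by omega)
  have e2 : (m + 2).choose (t + 1) ≤ (m + 3).choose (t + 1) := Nat.choose_le_choose (t + 1) (by omega)
  have e3 : (m + 3).choose (t + 1) ≤ (m + 4).choose (t + 1) := Nat.choose_le_choose (t + 1) (by omega)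
  have f0 : m.choose (t + 2) ≤ (m + 1).choose (t + 2) := Nat.choose_le_choose (t + 2) (by omega)
  have f1 : (m + 1).choose (t + 2) ≤ (m + 2).choose (t + 2) := Nat.choose_le_choose (t + 2) (by omega)
  have f2 : (m + 2).choose (t + 2) ≤ (m + 3).choose (t + 2) := Nat.choose_le_choose (t + 2) (by omega)
  have f3 : (m + 3).choose (t + 2) ≤ (m + 4).choose (t + 2) := Nat.choose_le_choose (t + 2) (by omega)
  have f4 : (m + 4).choose (t + 2) ≤ (m + 5).choose (t + 2) := Nat.choose_le_choose (t + 2) (by omega)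
  interval_cases p₀ <;> interval_cases p₁ <;> interval_cases p₂ <;>
    simp only [Nat.add_zero, Nat.add_assoc, Nat.reduceAdd] at * <;> omega

variable {α : Type*} [DecidableEq α] {M : Matroid α} [M.Finite]

/-- The triple trace is large when the missed parts are small:
`|S′ ∩ H₀ ∩ H₁ ∩ H₂| + |S′ ∖ H₀| + |S′ ∖ H₁| + |S′ ∖ H₂| ≥ |S′|`. -/
theorem card_inter_three_add_ge (H₀ H₁ H₂ S' : Finset α) :
    S'.card ≤ (S' ∩ H₀ ∩ H₁ ∩ H₂).card + (S' \ H₀).card + (S' \ H₁).card + (S' \ H₂).card := by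
  have hsub : S' ⊆ ((S' ∩ H₀ ∩ H₁ ∩ H₂) ∪ (S' \ H₀)) ∪ (S' \ H₁) ∪ (S' \ H₂) := by
    intro x hx
    simp only [Finset.mem_union, Finset.mem_inter, Finset.mem_sdiff]
    tauto
  have h1 := Finset.card_le_card hsub
  have h2 := Finset.card_union_le (((S' ∩ H₀ ∩ H₁ ∩ H₂) ∪ (S' \ H₀)) ∪ (S' \ H₁)) (S' \ H₂)
  have h3 := Finset.card_union_le ((S' ∩ H₀ ∩ H₁ ∩ H₂) ∪ (S' \ H₀)) (S' \ H₁)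
  have h4 := Finset.card_union_le (S' ∩ H₀ ∩ H₁ ∩ H₂) (S' \ H₀)
  omega

open scoped Classical in
/-- **Inclusion–exclusion over three rank-`≤ q` sets through the coloops**: no covering basis lies inside `H₀`, `H₁`
or `H₂`, so `#cb + Σ_i C(|S′ ∩ H_i|, ρ) + C(|S′ ∩ H₀ ∩ H₁ ∩ H₂|, ρ) ≤ C(|S′|, ρ) + Σ_{i<j} C(|S′ ∩ H_i ∩ H_j|, ρ)`. -/
theorem card_coverBases_le_of_three_subset_rank {q ρ : ℕ} {G : Finset α} (hk : kColoops M G + ρ = q + 1)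
    {H₀ H₁ H₂ : Finset α} (hK₀ : coloops M G ⊆ H₀) (hH₀ : M.eRk (H₀ : Set α) ≤ (q : ℕ∞))
    (hK₁ : coloops M G ⊆ H₁) (hH₁ : M.eRk (H₁ : Set α) ≤ (q : ℕ∞))
    (hK₂ : coloops M G ⊆ H₂) (hH₂ : M.eRk (H₂ : Set α) ≤ (q : ℕ∞)) (S : Finset α) :
    (coverBases M G S ρ).card + ((S \ coloops M G) ∩ H₀).card.choose ρ +
        ((S \ coloops M G) ∩ H₁).card.choose ρ + ((S \ coloops M G) ∩ H₂).card.choose ρ +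
        ((S \ coloops M G) ∩ H₀ ∩ H₁ ∩ H₂).card.choose ρ ≤
      (S \ coloops M G).card.choose ρ + ((S \ coloops M G) ∩ H₀ ∩ H₁).card.choose ρ +
        ((S \ coloops M G) ∩ H₀ ∩ H₂).card.choose ρ + ((S \ coloops M G) ∩ H₁ ∩ H₂).card.choose ρ := by
  set S' := S \ coloops M G with hS'
  set P₀ := (S' ∩ H₀).powersetCard ρ with hP₀
  set P₁ := (S' ∩ H₁).powersetCard ρ with hP₁
  set P₂ := (S' ∩ H₂).powersetCard ρ with hP₂
  -- no covering basis inside a rank-`≤ q` trace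
  have hnot : ∀ {H : Finset α}, coloops M G ⊆ H → M.eRk (H : Set α) ≤ (q : ℕ∞) →
      ∀ T ∈ coverBases M G S ρ, T ∉ (S' ∩ H).powersetCard ρ := by
    intro H hKH hH T hT hTH
    unfold coverBases at hT
    rw [Finset.mem_filter] at hT
    obtain ⟨hTp, hind⟩ := hT
    rw [Finset.mem_powersetCard] at hTp hTH
    have hTK : Disjoint (coloops M G) T := by
      rw [Finset.disjoint_left]
      intro x hx hxT
      exact (Finset.mem_sdiff.1 (hTp.1 hxT)).2 hx
    have hcard : (coloops M G ∪ T).card = q + 1 := by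
      rw [Finset.card_union_of_disjoint hTK, ← kColoops_eq_card_coloops, hTp.2, hk]
    have hKT : ((coloops M G ∪ T : Finset α) : Set α) ⊆ (H : Set α) := by
      rw [Finset.coe_subset]
      exact Finset.union_subset hKH (hTH.1.trans Finset.inter_subset_right)
    have h1 := hind.encard_le_eRk_of_subset hKT
    rw [Set.encard_coe_eq_coe_finsetCard, hcard] at h1
    have h2 : ((q + 1 : ℕ) : ℕ∞) ≤ (q : ℕ∞) := h1.trans hH
    have h3 : q + 1 ≤ q := by exact_mod_cast h2
    omega
  have hsub : coverBases M G S ρ ⊆ S'.powersetCard ρ \ (P₀ ∪ P₁ ∪ P₂) := by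
    intro T hT
    rw [Finset.mem_sdiff, Finset.mem_union, Finset.mem_union]
    refine ⟨?_, ?_⟩
    · unfold coverBases at hT
      exact (Finset.mem_filter.1 hT).1
    · rintro ((h | h) | h)
      · exact hnot hK₀ hH₀ T hT h
      · exact hnot hK₁ hH₁ T hT h
      · exact hnot hK₂ hH₂ T hT h
  have hUsub : P₀ ∪ P₁ ∪ P₂ ⊆ S'.powersetCard ρ := by
    apply Finset.union_subset
    · apply Finset.union_subset
      · exact Finset.powersetCard_mono Finset.inter_subset_left
      · exact Finset.powersetCard_mono Finset.inter_subset_left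
    · exact Finset.powersetCard_mono Finset.inter_subset_left
  have h1 := Finset.card_le_card hsub
  rw [Finset.card_sdiff_of_subset hUsub] at h1
  have hUle := Finset.card_le_card hUsub
  -- the three-set inclusion–exclusion
  have h2 := Finset.card_union_add_card_inter (P₀ ∪ P₁) P₂
  have h3 := Finset.card_union_add_card_inter P₀ P₁
  have hdist : (P₀ ∪ P₁) ∩ P₂ = (P₀ ∩ P₂) ∪ (P₁ ∩ P₂) := Finset.union_inter_distrib_right P₀ P₁ P₂
  have h4 := Finset.card_union_add_card_inter (P₀ ∩ P₂) (P₁ ∩ P₂)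
  have h01 : P₀ ∩ P₁ = (S' ∩ H₀ ∩ H₁).powersetCard ρ := by
    rw [hP₀, hP₁, powersetCard_inter_eq]
    congr 1
    ext x
    simp only [Finset.mem_inter]
    tauto
  have h02 : P₀ ∩ P₂ = (S' ∩ H₀ ∩ H₂).powersetCard ρ := by
    rw [hP₀, hP₂, powersetCard_inter_eq]
    congr 1
    ext x
    simp only [Finset.mem_inter]
    tauto
  have h12 : P₁ ∩ P₂ = (S' ∩ H₁ ∩ H₂).powersetCard ρ := by
    rw [hP₁, hP₂, powersetCard_inter_eq]
    congr 1
    ext x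
    simp only [Finset.mem_inter]
    tauto
  have h012 : (P₀ ∩ P₂) ∩ (P₁ ∩ P₂) = (S' ∩ H₀ ∩ H₁ ∩ H₂).powersetCard ρ := by
    rw [h02, h12, powersetCard_inter_eq]
    congr 1
    ext x
    simp only [Finset.mem_inter]
    tauto
  rw [hdist, h02, h12] at h2
  rw [h012, h02, h12] at h4
  rw [h01] at h3
  rw [Finset.card_powersetCard, Finset.card_powersetCard, Finset.card_powersetCard] at h4
  rw [Finset.card_powersetCard, Finset.card_powersetCard, Finset.card_powersetCard] at h3
  rw [Finset.card_powersetCard] at h2 h1 hUle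
  omega

open scoped Classical in
/-- **The three-disjoint-hyperplane count**: three rank-`≤ q` sets `H₀, H₁, H₂ ⊇ K` missing `≤ 2` points of `G`
each, with pairwise DISJOINT missed sets, bound the covering bases of every target `S ⊆ G` by
`cntDisjThree ρ |S ∖ K|` (`ρ ≥ 4`). -/
theorem card_coverBases_le_cntDisjThree {q ρ : ℕ} {G : Finset α} (hk : kColoops M G + ρ = q + 1) (hρ : 4 ≤ ρ)
    {H₀ H₁ H₂ : Finset α} (hK₀ : coloops M G ⊆ H₀) (hH₀ : M.eRk (H₀ : Set α) ≤ (q : ℕ∞))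
    (hK₁ : coloops M G ⊆ H₁) (hH₁ : M.eRk (H₁ : Set α) ≤ (q : ℕ∞))
    (hK₂ : coloops M G ⊆ H₂) (hH₂ : M.eRk (H₂ : Set α) ≤ (q : ℕ∞))
    (hm₀ : (G \ H₀).card ≤ 2) (hm₁ : (G \ H₁).card ≤ 2) (hm₂ : (G \ H₂).card ≤ 2)
    (hd₀₁ : (G \ H₀) ∩ (G \ H₁) = ∅) (hd₀₂ : (G \ H₀) ∩ (G \ H₂) = ∅) (hd₁₂ : (G \ H₁) ∩ (G \ H₂) = ∅)
    {S : Finset α} (hSG : S ⊆ G) :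
    ((coverBases M G S ρ).card : ℚ) ≤ cntDisjThree ρ (S \ coloops M G).card := by
  set S' := S \ coloops M G with hS'
  have hS'G : S' ⊆ G := Finset.sdiff_subset.trans hSG
  have h0 : (coverBases M G S ρ).card ≤ S'.card.choose ρ := card_coverBases_le G S ρ
  by_cases hsmall : S'.card ≤ ρ + 1
  · -- the count is the crude one: the corrections vanish
    unfold cntDisjThree
    rw [Nat.choose_eq_zero_of_lt (by omega : S'.card - 2 < ρ), Nat.choose_eq_zero_of_lt (by omega : S'.card - 4 < ρ)]
    have h5 := (Nat.cast_le (α := ℚ)).2 h0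
    push_cast at h5 ⊢
    linarith
  push Not at hsmall
  obtain ⟨t, rfl⟩ : ∃ t, ρ = t + 3 := ⟨ρ - 3, by omega⟩
  obtain ⟨m, hm⟩ : ∃ m, S'.card = m + 6 := ⟨S'.card - 6, by omega⟩
  have h1 := card_coverBases_le_of_three_subset_rank hk hK₀ hH₀ hK₁ hH₁ hK₂ hH₂ S
  rw [← hS'] at h1
  -- the missed parts of the target
  have ha₀ : (S' \ H₀).card ≤ 2 := (Finset.card_le_card (Finset.sdiff_subset_sdiff hS'G le_rfl)).trans hm₀
  have ha₁ : (S' \ H₁).card ≤ 2 := (Finset.card_le_card (Finset.sdiff_subset_sdiff hS'G le_rfl)).trans hm₁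
  have ha₂ : (S' \ H₂).card ≤ 2 := (Finset.card_le_card (Finset.sdiff_subset_sdiff hS'G le_rfl)).trans hm₂
  have hb₀ := Finset.card_sdiff_add_card_inter S' H₀
  have hb₁ := Finset.card_sdiff_add_card_inter S' H₁
  have hb₂ := Finset.card_sdiff_add_card_inter S' H₂
  have hx₀₁ := card_inter_inter_le (H₀ := H₀) (H₁ := H₁) hS'G
  have hx₀₂ := card_inter_inter_le (H₀ := H₀) (H₁ := H₂) hS'G
  have hx₁₂ := card_inter_inter_le (H₀ := H₁) (H₁ := H₂) hS'G
  rw [hd₀₁, Finset.card_empty] at hx₀₁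
  rw [hd₀₂, Finset.card_empty] at hx₀₂
  rw [hd₁₂, Finset.card_empty] at hx₁₂
  have hy := card_inter_three_add_ge H₀ H₁ H₂ S'
  -- name the complements `p_i = 2 − a_i`
  obtain ⟨p₀, hp₀⟩ : ∃ p₀, (S' \ H₀).card + p₀ = 2 := ⟨2 - (S' \ H₀).card, by omega⟩
  obtain ⟨p₁, hp₁⟩ : ∃ p₁, (S' \ H₁).card + p₁ = 2 := ⟨2 - (S' \ H₁).card, by omega⟩
  obtain ⟨p₂, hp₂⟩ : ∃ p₂, (S' \ H₂).card + p₂ = 2 := ⟨2 - (S' \ H₂).card, by omega⟩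
  have hcb₀ : (S' ∩ H₀).card = m + 4 + p₀ := by omega
  have hcb₁ : (S' ∩ H₁).card = m + 4 + p₁ := by omega
  have hcb₂ : (S' ∩ H₂).card = m + 4 + p₂ := by omega
  have hcx₀₁ : (S' ∩ H₀ ∩ H₁).card.choose (t + 3) ≤ (m + 2 + p₀ + p₁).choose (t + 3) :=
    Nat.choose_le_choose _ (by omega)
  have hcx₀₂ : (S' ∩ H₀ ∩ H₂).card.choose (t + 3) ≤ (m + 2 + p₀ + p₂).choose (t + 3) :=
    Nat.choose_le_choose _ (by omega)
  have hcx₁₂ : (S' ∩ H₁ ∩ H₂).card.choose (t + 3) ≤ (m + 2 + p₁ + p₂).choose (t + 3) :=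
    Nat.choose_le_choose _ (by omega)
  have hcy : (m + p₀ + p₁ + p₂).choose (t + 3) ≤ (S' ∩ H₀ ∩ H₁ ∩ H₂).card.choose (t + 3) :=
    Nat.choose_le_choose _ (by omega)
  have h3 := choose_three_disjoint_le t m p₀ p₁ p₂ (by omega) (by omega) (by omega)
  rw [hcb₀, hcb₁, hcb₂, hm] at h1
  have h4 : (coverBases M G S (t + 3)).card + 3 * (m + 4).choose (t + 3) ≤
      (m + 6).choose (t + 3) + 3 * (m + 2).choose (t + 3) := by omega
  unfold cntDisjThree
  rw [hm, show m + 6 - 2 = m + 4 by omega, show m + 6 - 4 = m + 2 by omega]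
  have h5 := (Nat.cast_le (α := ℚ)).2 h4
  push_cast at h5
  linarith

end PercRepro.Shadow
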